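import Summits.Schanuel.Schanuel.Theorems.DiophantineDichotomyKhovanskiiApproxTypeSiegelBox
import Literature.NumberTheory.DiophantineGeometry.AbcWave0BakerWustholzProofs
import Literature.NumberTheory.Transcendental.BakerFieldG
import HarnessLib

/-!
# Stub `stub_siegelInIdeal` of line `lw-small-height` (crux `KhovanskiiApproxType`)

Siegel's lemma inside the ideal of the challenger (`SiegelInIdeal`, defined in
`Summits.Schanuel.Schanuel.Theorems.DiophantineDichotomyDefs`): for every `m ≥ 1` there is a shape
`(A, B, E)` such that for every number field `F ⊂ ℂ` (`D = [F:ℚ]`), every `γ ∈ Fᵐ` and every `t`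
with `A (D+1) ≤ (t+1)^m =: N` there is a non-zero `Q ∈ ℤ[X₁,…,X_m]` supported on the box
`eᵢ ≤ t` with `Q(γ) = 0` and naive height `≤ B (t+1)^E exp(E t Σⱼ h(γⱼ))`.

Proof (box principle in one complex embedding + archimedean Liouville inequality):
* the `(B+1)^N` integer vectors `q ∈ {0,…,B}^{box}` give values `L(q) = Σ_e q_e γ^e` in the disc of
  radius `R = N B Θ`, `Θ = ∏ⱼ H(γⱼ)^{t+1}` (`‖γⱼ‖ ≤ H(γⱼ)`, the relative multiplicative height:
  `Literature.NumberTheory.Transcendental.norm_embedding_le_mulHeight₁`);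
* cutting the square of side `2R` into `n²` cells, two distinct `q ≠ q'` share a cell as soon as
  `(n+1)² < (B+1)^N`, so `β = L(q) − L(q')` has `‖β‖ ≤ 4R/n` (`siegel_exists_near`);
* `β ∈ F` has `H(β) ≤ 2^D ((N B)^D Θ)²` (heights of integer linear combinations of monomials:
  `siegel_mulHeight₁_linearForm_le`, Mathlib's `Height.mulHeight₁_sub_le`);
* if `β ≠ 0`, Liouville `‖β‖ ≥ H(β)⁻¹`
  (`Literature.NumberTheory.DiophantineGeometry.inv_mulHeight₁_le_norm_complexEmbedding`)
  contradicts `‖β‖ ≤ 4R/n < H(β)⁻¹` for `n = ⌊4 R · 2^D ((N B)^D Θ)²⌋ + 1`; the choice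
  `B = ⌊2N e^{2(t+1)S}⌋ + 1`, `A = 8` makes `(n+1)² < (B+1)^N` hold (`siegel_count`).
Hence `Q := Σ_e (q_e − q'_e) X^e` works (`siegel_boxPoly`), with
`H(Q) ≤ B ≤ 3 (t+1)^{m+4} e^{(m+4) t S}` (`siegel_final_bound`); the shape is
`(A, B, E) = (8, 3, m + 4)`.
-/

noncomputable section

-- `Summit.Schanuel.Schanuel.…` is the mandated summit/sub-problem namespace (single-conjunct summit), hence:
set_option linter.dupNamespace false

open scoped BigOperators

namespace Summit.Schanuel.Schanuel.Cruxes.KhovanskiiApproxType.LwSmallHeight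

open Literature.NumberTheory.Transcendental (weilHeight₁ weilHeight₁_single_eq weilHeight₁_nonneg
  numberField_of_intermediateField norm_embedding_le_mulHeight₁)
open Literature.NumberTheory.DiophantineGeometry (inv_mulHeight₁_le_norm_complexEmbedding)
open NumberField Height Finset

/-! ### The core: box principle against Liouville in a number field -/

/-- **Siegel's lemma inside the ideal, core step.** For a number field `K` with a complex embedding
`σ`, a point `y ∈ Kᵐ`, a box size `t`, a coefficient bound `B ≥ 1` and a grid size `n ≥ 1` with
`(n+1)² < (B+1)^N` (`N = (t+1)^m`) and `n > 4 R · 2^{[K:ℚ]} ((N B)^{[K:ℚ]} Θ)²`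
(`R = N B Θ`, `Θ ≥ ∏ⱼ H(yⱼ)^{t+1}`), there is a non-zero integer vector `c` on the box with
`|c_e| ≤ B` and `Σ_e c_e σ(y)^e = 0`. [folklore] -/
theorem siegel_core {K : Type*} [Field K] [NumberField K] (σ : K →+* ℂ) {m t B n : ℕ}
    (hB : 1 ≤ B) (hn : 0 < n) (y : Fin m → K) {Θ : ℝ} (hΘ : ∏ j, mulHeight₁ (y j) ^ (t + 1) ≤ Θ)
    (hcount : (n + 1) ^ 2 < (B + 1) ^ ((t + 1) ^ m))
    (hXn : 4 * ((((t + 1) ^ m * B : ℕ) : ℝ) * Θ) *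
      (2 ^ Module.finrank ℚ K * ((((t + 1) ^ m * B : ℕ) : ℝ) ^ Module.finrank ℚ K * Θ) *
        ((((t + 1) ^ m * B : ℕ) : ℝ) ^ Module.finrank ℚ K * Θ)) < n) :
    ∃ c : (Fin m → Fin (t + 1)) → ℤ, c ≠ 0 ∧ (∀ e, (c e).natAbs ≤ B) ∧
      ∑ e, (c e : ℂ) * ∏ j, σ (y j) ^ (e j : ℕ) = 0 := by
  classical
  set D : ℕ := Module.finrank ℚ K with hD
  set P : ℝ := (((t + 1) ^ m * B : ℕ) : ℝ) with hP_def
  have hΘ1 : 1 ≤ Θ :=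
    le_trans (Finset.one_le_prod fun j _ => one_le_pow₀ (one_le_mulHeight₁ _)) hΘ
  have hP1 : 1 ≤ P := by
    rw [hP_def]
    exact_mod_cast Nat.one_le_iff_ne_zero.mpr
      (Nat.mul_ne_zero (pow_ne_zero _ t.succ_ne_zero) (by omega))
  set R : ℝ := P * Θ with hR_def
  have hRpos : 0 < R := mul_pos (by linarith) (by linarith)
  set Hb : ℝ := 2 ^ D * (P ^ D * Θ) * (P ^ D * Θ) with hHb_def
  have hHbpos : 0 < Hb := by positivity
  set X : ℝ := 4 * R * Hb with hX_def
  have hXpos : 0 < X := by positivity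
  -- the linear forms `L(q)`, `q ∈ {0,…,B}^box`
  set L : ((Fin m → Fin (t + 1)) → Fin (B + 1)) → K := fun q =>
    ∑ e, ((q e : ℕ) : K) * ∏ j, y j ^ (e j : ℕ) with hL_def
  have hσL : ∀ q, σ (L q) = ∑ e, ((q e : ℕ) : ℂ) * ∏ j, σ (y j) ^ (e j : ℕ) := by
    intro q
    simp only [hL_def, map_sum, map_mul, map_natCast, map_prod, map_pow]
  -- their values in `ℂ` lie in the disc of radius `R`
  have hyH : ∀ j, ‖σ (y j)‖ ≤ mulHeight₁ (y j) := fun j => norm_embedding_le_mulHeight₁ σ (y j)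
  have hLR : ∀ q : (Fin m → Fin (t + 1)) → Fin (B + 1), ‖σ (L q)‖ ≤ R := by
    intro q
    rw [hσL]
    have h := siegel_norm_linearForm_le (fun j => σ (y j)) (fun j => mulHeight₁ (y j)) hyH
      (fun j => one_le_mulHeight₁ _) q
    calc _ ≤ _ := h
      _ ≤ R := by
          rw [hR_def, hP_def]; push_cast
          exact mul_le_mul_of_nonneg_left hΘ (by positivity)
  have hcardbox : Fintype.card (Fin m → Fin (t + 1)) = (t + 1) ^ m := by simp
  have hcard : (n + 1) ^ 2 < Fintype.card ((Fin m → Fin (t + 1)) → Fin (B + 1)) := by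
    rwa [Fintype.card_fun, Fintype.card_fin, hcardbox]
  -- the box principle: two distinct coefficient vectors with close values
  obtain ⟨q, q', hqq', hnear⟩ := siegel_exists_near (fun q => σ (L q)) hRpos hn hLR hcard
  -- the coefficient vector `c = q − q'` and the algebraic number `β = L(q) − L(q')`
  set c : (Fin m → Fin (t + 1)) → ℤ := fun e => ((q e : ℕ) : ℤ) - ((q' e : ℕ) : ℤ) with hc_def
  have hc0 : c ≠ 0 := by
    obtain ⟨e, he⟩ := Function.ne_iff.mp hqq'
    refine Function.ne_iff.mpr ⟨e, ?_⟩
    have h : (q e : ℕ) ≠ (q' e : ℕ) := fun h => he (Fin.ext h)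
    simp only [hc_def, Pi.zero_apply]; omega
  have hcB : ∀ e, (c e).natAbs ≤ B := by
    intro e
    have h1 := Nat.lt_succ_iff.mp (q e).is_lt
    have h2 := Nat.lt_succ_iff.mp (q' e).is_lt
    simp only [hc_def]; omega
  set β : K := L q - L q' with hβ_def
  have hsum : ∑ e, (c e : ℂ) * ∏ j, σ (y j) ^ (e j : ℕ) = σ β := by
    rw [hβ_def, map_sub, hσL, hσL, ← Finset.sum_sub_distrib]
    refine Finset.sum_congr rfl fun e _ => ?_
    simp only [hc_def]; push_cast; ring
  -- the height of `β`
  have hHL : ∀ q : (Fin m → Fin (t + 1)) → Fin (B + 1), mulHeight₁ (L q) ≤ P ^ D * Θ := fun q =>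
    (siegel_mulHeight₁_linearForm_le (t := t) hB y q).trans
      (mul_le_mul_of_nonneg_left hΘ (by positivity))
  have hHβ : mulHeight₁ β ≤ Hb := by
    calc mulHeight₁ β ≤ 2 ^ totalWeight K * mulHeight₁ (L q) * mulHeight₁ (L q') :=
          mulHeight₁_sub_le _ _
      _ ≤ 2 ^ D * (P ^ D * Θ) * (P ^ D * Θ) := by
          rw [NumberField.totalWeight_eq_finrank, ← hD]
          exact mul_le_mul (mul_le_mul_of_nonneg_left (hHL q) (by positivity)) (hHL q')
            (mulHeight₁_pos _).le (by positivity)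
  -- `β = 0`: otherwise Liouville's inequality contradicts the smallness of `σ β`
  have hβ0 : β = 0 := by
    by_contra hne
    have hLiou := inv_mulHeight₁_le_norm_complexEmbedding σ hne
    have hlow : Hb⁻¹ ≤ ‖σ β‖ := (inv_anti₀ (mulHeight₁_pos β) hHβ).trans hLiou
    have hup : ‖σ β‖ < Hb⁻¹ := by
      calc ‖σ β‖ = ‖σ (L q) - σ (L q')‖ := by rw [hβ_def, map_sub]
        _ ≤ 4 * R / n := hnear
        _ < 4 * R / X := div_lt_div_of_pos_left (by positivity) hXpos hXn
        _ = Hb⁻¹ := by rw [hX_def]; field_simp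
    exact absurd (hlow.trans_lt hup) (lt_irrefl _)
  exact ⟨c, hc0, hcB, by rw [hsum, hβ0, map_zero]⟩

/-! ### The stub -/

/-- **`stub_siegelInIdeal` — Siegel's lemma inside the ideal of the challenger** (registered stub of
line `lw-small-height`, crux `KhovanskiiApproxType`): `SiegelInIdeal` holds, with the shape
`(A, B, E) = (8, 3, m + 4)` in `m ≥ 1` variables.  Box principle on `{0,…,B}^N`,
`N = (t+1)^m ≥ 8([F:ℚ]+1)`, in the complex embedding of `F`, against the archimedean Liouville
inequality `‖β‖ ≥ H_F(β)⁻¹` for the difference `β ∈ F` of two colliding linear forms. -/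
theorem stub_siegelInIdeal : SiegelInIdeal := by
  intro m hm
  refine ⟨8, 3, (m : ℝ) + 4, by norm_num, by norm_num, by positivity, ?_⟩
  intro F _ γ hγ t ht
  classical
  haveI hNF : NumberField F := numberField_of_intermediateField F
  -- the field data
  set D : ℕ := Module.finrank ℚ F with hD
  have hD1 : 1 ≤ D := Module.finrank_pos
  have hDpos : (0 : ℝ) < D := by exact_mod_cast hD1
  set σ : F →+* ℂ := algebraMap F ℂ with hσ
  set γ' : Fin m → F := fun j => ⟨γ j, hγ j⟩ with hγ'
  have hσγ : ∀ j, σ (γ' j) = γ j := fun j => rfl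
  set S : ℝ := ∑ j, weilHeight₁ F (fun _ : Unit => γ j) with hS_def
  set T : ℝ := ∑ j, logHeight₁ (γ' j) with hT_def
  have hS0 : 0 ≤ S := Finset.sum_nonneg fun j _ => weilHeight₁_nonneg F _
  have hTS : T = D * S := by
    have h : S = T / D := by
      rw [hS_def, hT_def, Finset.sum_div]
      refine Finset.sum_congr rfl fun j _ => ?_
      rw [weilHeight₁_single_eq F (hγ j)]
    rw [h, mul_div_cancel₀ _ hDpos.ne']
  -- the box
  set N : ℕ := (t + 1) ^ m with hN
  have hNreal : (N : ℝ) = ((t : ℝ) + 1) ^ m := by simp [hN]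
  have hNge : 8 * D + 8 ≤ N := by
    have h : ((8 * D + 8 : ℕ) : ℝ) ≤ N := by rw [hNreal]; push_cast; linarith
    exact_mod_cast h
  have ht1 : 1 ≤ t := by
    rcases Nat.eq_zero_or_pos t with h0 | h0
    · have : N = 1 := by rw [hN, h0]; simp
      omega
    · exact h0
  -- heights of the coordinates
  set Θ : ℝ := ∏ j, mulHeight₁ (γ' j) ^ (t + 1) with hΘ_def
  have hΘ1 : 1 ≤ Θ := Finset.one_le_prod fun j _ => one_le_pow₀ (one_le_mulHeight₁ _)
  have hΘexp : Real.exp (((t : ℝ) + 1) * T) = Θ := by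
    rw [hT_def, Finset.mul_sum, Real.exp_sum]
    refine Finset.prod_congr rfl fun j _ => ?_
    rw [logHeight₁_eq_log_mulHeight₁, show ((t : ℝ) + 1) * Real.log (mulHeight₁ (γ' j)) =
      Real.log (mulHeight₁ (γ' j) ^ (t + 1)) by rw [Real.log_pow]; push_cast; ring,
      Real.exp_log (pow_pos (mulHeight₁_pos _) _)]
  -- the parameters `Φ`, `B`, `X`, `n`
  set Φ : ℝ := Real.exp (2 * ((t : ℝ) + 1) * S) with hΦ_def
  have hΦ0 : 0 ≤ Φ := (Real.exp_pos _).le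
  set B : ℕ := ⌊2 * N * Φ⌋₊ + 1 with hB_def
  have hB1 : 1 ≤ B := Nat.le_add_left 1 _
  have hyB : 2 * (N : ℝ) * Φ < B := by rw [hB_def]; push_cast; exact Nat.lt_floor_add_one _
  have hBy : (B : ℝ) ≤ 2 * ((t : ℝ) + 1) ^ m * Real.exp (2 * ((t : ℝ) + 1) * S) + 1 := by
    rw [hB_def, ← hNreal]; push_cast
    linarith [Nat.floor_le (show (0 : ℝ) ≤ 2 * N * Φ by positivity)]
  set X : ℝ := 4 * (((N * B : ℕ) : ℝ) * Θ) *
    (2 ^ D * (((N * B : ℕ) : ℝ) ^ D * Θ) * (((N * B : ℕ) : ℝ) ^ D * Θ)) with hX_def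
  have hX0 : 0 ≤ X := by positivity
  set n : ℕ := ⌊X⌋₊ + 1 with hn_def
  have hn0 : 0 < n := Nat.succ_pos _
  have hXn : X < n := by rw [hn_def]; push_cast; exact Nat.lt_floor_add_one _
  have hnX : (n : ℝ) ≤ X + 1 := by
    rw [hn_def]; push_cast
    linarith [Nat.floor_le hX0]
  -- counting
  have hΘΦ : Θ ^ 6 ≤ Φ ^ (4 * D + 6) := by
    rw [← hΘexp, hTS]
    exact siegel_exp_pow_le hS0
  have hcount : (n + 1) ^ 2 < (B + 1) ^ N := siegel_count hD1 hNge hΘ1 hΦ0 hΘΦ hyB hnX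
  -- the core, and the polynomial
  obtain ⟨c, hc0, hcB, hval⟩ := siegel_core σ hB1 hn0 γ' (Θ := Θ) le_rfl hcount hXn
  obtain ⟨Q, hQ0, hQsupp, hQht, hQval⟩ := siegel_boxPoly c hc0 hcB
  refine ⟨Q, hQ0, hQsupp, ?_, ?_⟩
  · rw [hQval γ]
    simpa only [hσγ] using hval
  · have h1 : (mvNatHeight Q : ℝ) ≤ B := by exact_mod_cast hQht
    exact siegel_final_bound hm ht1 hS0 (h1.trans hBy)

end Summit.Schanuel.Schanuel.Cruxes.KhovanskiiApproxType.LwSmallHeight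

end
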